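import Mathlib
import HarnessLib
import Summits.Ventures.LatticeQCDFlow.Scoring.AgreementToleranceTest
import Summits.Ventures.LatticeQCDFlow.Scoring.AgreementTestLocalPower
import Summits.Ventures.LatticeQCDFlow.Scoring.SimultaneousAgreementTwoSigma

/-!
# THE POWER FUNCTION OF THE "WITHIN 3 pp" EQUIVALENCE RULE UNDER LOCAL ALTERNATIVES: IF THE TRUE
# DISCREPANCY SITS `h` COMBINED STANDARD ERRORS INSIDE THE TOLERANCE, THE RULE PASSES WITH
# PROBABILITY `→ N(0,1)((−∞, h − z])`

HONEST FRAMING: exact (Metropolis-corrected) sampling algorithms for lattice gauge theory;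
figures of merit are autocorrelation/cost numbers at stated couplings and volumes; no
continuum-physics claim.

Venture `LatticeQCDFlow` (cell pub-lqcd), topic `Scoring`; FANOUT row 4 (`s0-u1-b`, GEN-35).
NEW WORK of the cell (textbook asymptotics of the two one-sided tests procedure; our
formalisation), no definition, nothing cited as a fact (Schuirmann's TOST NAMED ONLY).

WHY (row 4).  `Scoring/AgreementToleranceTest` gives the three coarse operating characteristics of
the confidence-adjusted tolerance rule `|Sₙ^A − S_{mₙ}^B| + z √(V̂ₙ^A + V̂_{mₙ}^B) ≤ ε`: inside → 1,
outside → 0, and AT the boundary an upper bound `N(0,1)((−∞, −z]) + η`.  This file supplies the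
whole POWER FUNCTION on the `1/√n` scale around the boundary, in the local-alternative setting of
`Scoring/AgreementTestLocalPower` (code `B` with a possibly moving target `bₙ`): if
`(a − b_{mₙ} − ε)/√(s_A/n + s_B/mₙ) → −h` — the true discrepancy is `h` TRUE combined standard errors
INSIDE the tolerance (`h < 0`: outside) — then
`P(|Sₙ^A − S_{mₙ}^B| + z √(V̂ₙ^A + V̂_{mₙ}^B) ≤ ε) → N(0,1)((−∞, h − z])`
(**`twoSample_tolerance_localPower`**).  Proof: recentring code `B` by `ε` puts the pair under the
local alternative `δ = −h` of `twoSample_agreement_local_clt`, so `T'ₙ = (Dₙ − ε)/σ̂ₙ ⇒ Z − h`; on the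
event `{Dₙ > 0} ∩ {σ̂ₙ > 0}`, whose probability `→ 1` (`Dₙ → ε > 0` in probability, `n·V̂ₙ^A → s_A > 0`),
the pass event IS `{T'ₙ ≤ −z}`; portmanteau.  Readings (**`gaussianReal_real_Iic_sub_self`**,
`…_mono`): at the exact boundary `h = 0` the limit is `N(0,1)((−∞,−z])` — the boundary bound of that
file is attained; the limit is increasing in `h`, equals `1/2` at `h = z`, and tends to `1` / `0` as
`h → +∞` / `−∞` (**`tendsto_gaussianReal_real_Iic_atTop`**, `…_atBot`), interpolating the inside /
outside theorems; and the Mills envelopes of `Scoring/SimultaneousAgreementTwoSigma` make it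
quantitative without a table: `x > 0` combined standard errors INSIDE the margin-adjusted boundary
(`h = z + x`) the limiting pass probability is `≥ 1 − φ(x)/x`, and `x` OUTSIDE it (`h = z − x`) it is
`≤ φ(x)/x` (**`gaussianReal_real_Iic_ge_one_sub_mills`**, **`gaussianReal_real_Iic_neg_le_mills`**).

NOT CLAIMED: rates; dependent codes; numbers for the cell's runs.
-/

noncomputable section

namespace Summit.Ventures.LatticeQCDFlow.Scoring.CardConsistency

open MeasureTheory ProbabilityTheory Filter Set
open scoped Topology ENNReal NNReal

/-! ## §1 One-dimensional readings -/

section Readings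

/-- `h ↦ N(0,1)((−∞, h − z])` is monotone. [folklore] -/
theorem gaussianReal_real_Iic_sub_mono (z : ℝ) :
    Monotone fun h : ℝ => (gaussianReal 0 1).real (Iic (h - z)) :=
  fun _ _ hle => measureReal_mono (Iic_subset_Iic.2 (by linarith))

/-- At `h = z` the limit is `1/2`. [folklore] -/
theorem gaussianReal_real_Iic_sub_self (z : ℝ) :
    (gaussianReal 0 1).real (Iic (z - z)) = 1 / 2 := by
  rw [sub_self, gaussianReal_real_Iic_zero]

/-- `N(0,1)((−∞, h − z]) → 1` as `h → +∞`. [folklore] -/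
theorem tendsto_gaussianReal_real_Iic_atTop (z : ℝ) :
    Tendsto (fun h : ℝ => (gaussianReal 0 1).real (Iic (h - z))) atTop (𝓝 1) := by
  have h1 : Tendsto (fun h : ℝ => (gaussianReal 0 1) (Iic (h - z))) atTop (𝓝 ((gaussianReal 0 1) univ)) := by
    rw [← iUnion_Iic_sub z]
    exact tendsto_measure_iUnion_atTop (monotone_Iic_sub z)
  rw [measure_univ] at h1
  have h2 := (ENNReal.tendsto_toReal ENNReal.one_ne_top).comp h1
  rw [ENNReal.toReal_one] at h2
  exact h2
where
  /-- `⋃_h (−∞, h − z] = ℝ`. -/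
  iUnion_Iic_sub (z : ℝ) : (⋃ h : ℝ, Iic (h - z)) = (univ : Set ℝ) := by
    ext t
    simp only [mem_iUnion, mem_Iic, mem_univ, iff_true]
    exact ⟨t + z, by linarith⟩
  /-- `h ↦ (−∞, h − z]` is monotone. -/
  monotone_Iic_sub (z : ℝ) : Monotone fun h : ℝ => Iic (h - z) :=
    fun _ _ hle => Iic_subset_Iic.2 (by linarith)

/-- `N(0,1)((−∞, h − z]) → 0` as `h → −∞`. [folklore] -/
theorem tendsto_gaussianReal_real_Iic_atBot (z : ℝ) :
    Tendsto (fun h : ℝ => (gaussianReal 0 1).real (Iic (h - z))) atBot (𝓝 0) := by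
  -- via the c.d.f., which tends to `0` at `−∞`
  have hcdf : ∀ h : ℝ, (gaussianReal 0 1).real (Iic (h - z)) = cdf (gaussianReal 0 1) (h - z) :=
    fun h => by rw [cdf_eq_real]
  simp only [hcdf]
  exact (tendsto_cdf_atBot (gaussianReal 0 1)).comp
    (tendsto_atBot_add_const_right _ (-z) tendsto_id)

/-- **Mills, lower envelope**: `x > 0` ⇒ `1 − φ(x)/x ≤ N(0,1)((−∞, x])` — `x` combined standard
errors inside the margin-adjusted boundary the rule passes with limiting probability at least
`1 − φ(x)/x`. [ours] -/
theorem gaussianReal_real_Iic_ge_one_sub_mills {x : ℝ} (hx : 0 < x) :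
    1 - gaussianPDFReal 0 1 x / x ≤ (gaussianReal 0 1).real (Iic x) := by
  have hcompl : (gaussianReal 0 1).real (Iic x) = 1 - (gaussianReal 0 1).real (Ioi x) := by
    rw [← compl_Iic, probReal_compl_eq_one_sub measurableSet_Iic]
    ring
  rw [hcompl]
  linarith [gaussianReal_real_Ioi_le hx]

/-- **Mills, upper envelope**: `x > 0` ⇒ `N(0,1)((−∞, −x]) ≤ φ(x)/x` — `x` combined standard errors
outside the margin-adjusted boundary the rule passes with limiting probability at most `φ(x)/x`. [ours] -/
theorem gaussianReal_real_Iic_neg_le_mills {x : ℝ} (hx : 0 < x) :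
    (gaussianReal 0 1).real (Iic (-x)) ≤ gaussianPDFReal 0 1 x / x := by
  have h1 : (gaussianReal 0 1).real (Iic (-x)) = (gaussianReal 0 1).real (Iio (-x)) := by
    haveI := nullSingletonClass_gaussianReal (μ := (0 : ℝ)) one_ne_zero
    exact measureReal_congr Iio_ae_eq_Iic.symm
  rw [h1, gaussianReal_real_Iio_neg_eq]
  exact gaussianReal_real_Ioi_le hx

end Readings

/-! ## §2 The local power of the tolerance rule -/

section Tolerance

variable {ΩA : Type*} [MeasurableSpace ΩA] {PA : Measure ΩA} [IsProbabilityMeasure PA]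
variable {ΩB : Type*} [MeasurableSpace ΩB] {PB : Measure ΩB} [IsProbabilityMeasure PB]
variable {Ω' : Type*} [MeasurableSpace Ω'] {P' : Measure Ω'} [IsProbabilityMeasure P']

set_option maxHeartbeats 400000 in
/-- **THE LOCAL POWER OF THE TOLERANCE RULE.**  Code `A`: `√n(Sₙ^A − a) ⇒ N(0, s_A)`; code `B` with
moving target: `√n(Sₙ^B − bₙ) ⇒ N(0, s_B)`; `n·V̂ₙ^X → s_X > 0` in probability; `V̂^B ≥ 0`; code `B`
read along `mₙ → ∞`; independent runs.  If `(a − b_{mₙ} − ε)/√(s_A/n + s_B/mₙ) → −h` with `ε > 0`,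
then for every margin `z`,
`(P_A ⊗ P_B)(|Sₙ^A − S_{mₙ}^B| + z √(V̂ₙ^A + V̂_{mₙ}^B) ≤ ε) → N(0,1)((−∞, h − z])`. [ours] -/
theorem twoSample_tolerance_localPower {SA VA : ℕ → ΩA → ℝ} {SB VB : ℕ → ΩB → ℝ}
    {a sA sB ε h : ℝ} {b : ℕ → ℝ} {ZA ZB Z : Ω' → ℝ} (hε : 0 < ε) (hsA : 0 < sA) (hsB : 0 < sB)
    (hSAm : ∀ n, Measurable (SA n)) (hVAm : ∀ n, Measurable (VA n))
    (hSBm : ∀ n, Measurable (SB n)) (hVBm : ∀ n, Measurable (VB n))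
    (hVB0 : ∀ n ω, 0 ≤ VB n ω)
    (hcltA : TendstoInDistribution (fun (n : ℕ) ω => Real.sqrt n * (SA n ω - a)) atTop ZA
      (fun _ => PA) P') (hZA : HasLaw ZA (gaussianReal 0 sA.toNNReal) P')
    (hcltB : TendstoInDistribution (fun (n : ℕ) ω => Real.sqrt n * (SB n ω - b n)) atTop ZB
      (fun _ => PB) P') (hZB : HasLaw ZB (gaussianReal 0 sB.toNNReal) P')
    (hVA : TendstoInMeasure PA (fun (n : ℕ) ω => (n : ℝ) * VA n ω) atTop fun _ => sA)
    (hVB : TendstoInMeasure PB (fun (n : ℕ) ω => (n : ℝ) * VB n ω) atTop fun _ => sB)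
    {m : ℕ → ℕ} (hm : Tendsto m atTop atTop)
    (hloc : Tendsto (fun n : ℕ => (a - b (m n) - ε) / Real.sqrt (sA / n + sB / (m n))) atTop (𝓝 (-h)))
    (hZ : HasLaw Z (gaussianReal 0 1) P') (z : ℝ) :
    Tendsto (fun n => (PA.prod PB).real {ω : ΩA × ΩB |
        |SA n ω.1 - SB (m n) ω.2| + z * Real.sqrt (VA n ω.1 + VB (m n) ω.2) ≤ ε})
      atTop (𝓝 ((gaussianReal 0 1).real (Iic (h - z)))) := by
  -- Step 1: recentre code `B` by `ε`: target `bₙ + ε`, local alternative `δ = −h`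
  set SB' : ℕ → ΩB → ℝ := fun k ω => SB k ω + ε with hSB'
  have hSB'm : ∀ n, Measurable (SB' n) := fun n => (hSBm n).add_const _
  have hcltB' : TendstoInDistribution (fun (n : ℕ) ω => Real.sqrt n * (SB' n ω - (b n + ε))) atTop ZB
      (fun _ => PB) P' := by
    refine hcltB.congr (fun n => Eventually.of_forall fun ω => ?_) EventuallyEq.rfl
    simp only [hSB']
    ring
  have hloc' : Tendsto (fun n : ℕ => (a - (b (m n) + ε)) / Real.sqrt (sA / n + sB / (m n))) atTop
      (𝓝 (-h)) := by
    refine hloc.congr fun n => ?_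
    ring_nf
  have hT := twoSample_agreement_local_clt hsA hsB hSAm hVAm hSB'm hVBm hcltA hZA hcltB' hZB
    hVA hVB hm hloc' hZ
  -- Step 2: `P(T'ₙ ≤ −z) → P'(Z − h ≤ −z) = N(0,1)((−∞, h − z])`
  have hZh : HasLaw (fun ω => Z ω + -h) (gaussianReal (0 + -h) 1) P' := gaussianReal_add_const hZ (-h)
  have hfr : (P'.map fun ω => Z ω + -h) (frontier (Iic (-z))) = 0 := by
    rw [frontier_Iic, hZh.map_eq]
    haveI := nullSingletonClass_gaussianReal (μ := 0 + -h) one_ne_zero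
    exact measure_singleton _
  have hlim := tendsto_measureReal_preimage_of_tendstoInDistribution hT measurableSet_Iic hfr
  have hZev : P'.real ((fun ω => Z ω + -h) ⁻¹' Iic (-z)) = (gaussianReal 0 1).real (Iic (h - z)) := by
    rw [measureReal_def, measureReal_def, ← Measure.map_apply_of_aemeasurable hZh.aemeasurable
      measurableSet_Iic, hZh.map_eq, ← gaussianReal_map_add_const (μ := 0) (v := 1) (-h),
      Measure.map_apply (measurable_add_const _) measurableSet_Iic]
    congr 2
    ext t
    simp only [mem_preimage, mem_Iic]
    constructor <;> intro ht <;> linarith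
  rw [hZev] at hlim
  -- Step 3: the two bad events have vanishing probability
  -- (a) the error bar of code `A` degenerates: `n V̂ₙ^A ≤ s_A/2`
  have hbadV : Tendsto (fun n : ℕ => (PA.prod PB).real {ω : ΩA × ΩB | (n : ℝ) * VA n ω.1 ≤ sA / 2})
      atTop (𝓝 0) :=
    tendsto_measureReal_le_zero_of_tendstoInMeasure_gt (tendstoInMeasure_comp_fst (PB := PB) hVA)
      (by linarith)
  -- (b) the difference is not clearly positive: `Dₙ ≤ ε/2`, while `Dₙ → ε` in probability
  have hSA : TendstoInMeasure PA SA atTop fun _ => a :=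
    tendstoInMeasure_of_tendstoInDistribution_scaled
      (Real.tendsto_sqrt_atTop.comp tendsto_natCast_atTop_atTop) hcltA
  have hSBc : TendstoInMeasure PB (fun n ω => SB n ω - b n) atTop fun _ => (0 : ℝ) := by
    have hclt0 : TendstoInDistribution (fun (n : ℕ) ω => Real.sqrt n * ((SB n ω - b n) - 0)) atTop ZB
        (fun _ => PB) P' := by
      simpa only [sub_zero] using hcltB
    exact tendstoInMeasure_of_tendstoInDistribution_scaled
      (Real.tendsto_sqrt_atTop.comp tendsto_natCast_atTop_atTop) hclt0
  have hSA' := tendstoInMeasure_comp_fst (PB := PB) hSA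
  have hSB' := tendstoInMeasure_comp_snd (PA := PA) (tendstoInMeasure_comp_tendsto hSBc hm)
  have hσ : Tendsto (fun n : ℕ => Real.sqrt (sA / n + sB / (m n))) atTop (𝓝 0) := by
    have h1 : Tendsto (fun n : ℕ => sA / (n : ℝ)) atTop (𝓝 0) :=
      tendsto_const_nhds.div_atTop tendsto_natCast_atTop_atTop
    have h2 : Tendsto (fun n : ℕ => sB / ((m n : ℕ) : ℝ)) atTop (𝓝 0) :=
      tendsto_const_nhds.div_atTop (tendsto_natCast_atTop_atTop.comp hm)
    have h12 := h1.add h2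
    rw [add_zero] at h12
    have h3 := (Real.continuous_sqrt.tendsto 0).comp h12
    rw [Real.sqrt_zero] at h3
    exact h3
  have hgap : Tendsto (fun n => a - b (m n)) atTop (𝓝 ε) := by
    have hprod := hloc.mul hσ
    rw [mul_zero] at hprod
    have hev : ∀ᶠ n : ℕ in atTop, (a - b (m n) - ε) / Real.sqrt (sA / n + sB / (m n))
        * Real.sqrt (sA / n + sB / (m n)) = a - b (m n) - ε := by
      filter_upwards [eventually_ge_atTop 1] with n hn
      have hn0 : (0 : ℝ) < n := by exact_mod_cast hn
      have hpos : 0 < Real.sqrt (sA / n + sB / (m n)) :=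
        Real.sqrt_pos.2 (add_pos_of_pos_of_nonneg (div_pos hsA hn0) (div_nonneg hsB.le (Nat.cast_nonneg _)))
      field_simp
    have h0 : Tendsto (fun n => a - b (m n) - ε) atTop (𝓝 0) := hprod.congr' hev
    have h1 := h0.add_const ε
    simp only [zero_add, sub_add_cancel] at h1
    exact h1
  have hbdet : TendstoInMeasure (PA.prod PB) (fun (n : ℕ) (_ : ΩA × ΩB) => b (m n)) atTop
      fun _ => a - ε := by
    refine tendstoInMeasure_of_tendsto_ae (fun n => aestronglyMeasurable_const)
      (Eventually.of_forall fun _ => ?_)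
    have h1 := hgap.const_sub a
    have e : (fun n => a - (a - b (m n))) = fun n => b (m n) := by funext n; ring
    rw [e] at h1
    exact h1
  have hD : TendstoInMeasure (PA.prod PB) (fun n (ω : ΩA × ΩB) => SA n ω.1 - SB (m n) ω.2) atTop
      fun _ => ε := by
    -- first `Sₙ^A − (S^B_{mₙ} − b_{mₙ}) → a − 0`, then subtract the deterministic `b_{mₙ} → a − ε`
    have hφ : ContinuousAt (fun p : ℝ × ℝ => p.1 - p.2) (a, (0 : ℝ)) := by fun_prop
    have h1 := tendstoInMeasure_comp_continuousAt_normed (tendstoInMeasure_prodMk hSA' hSB') hφ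
    have hψ : ContinuousAt (fun p : ℝ × ℝ => p.1 - p.2) (a - 0, a - ε) := by fun_prop
    have h2 := tendstoInMeasure_comp_continuousAt_normed (tendstoInMeasure_prodMk h1 hbdet) hψ
    refine h2.congr' (Eventually.of_forall fun n => Eventually.of_forall fun ω => ?_)
      (Eventually.of_forall fun ω => ?_)
    · show SA n ω.1 - (SB (m n) ω.2 - b (m n)) - b (m n) = SA n ω.1 - SB (m n) ω.2
      ring
    · show a - 0 - (a - ε) = ε
      ring
  have hbadD : Tendsto (fun n : ℕ => (PA.prod PB).real {ω : ΩA × ΩB | SA n ω.1 - SB (m n) ω.2 ≤ ε / 2})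
      atTop (𝓝 0) :=
    tendsto_measureReal_le_zero_of_tendstoInMeasure_gt hD (by linarith)
  have hbad := hbadV.add hbadD
  rw [add_zero] at hbad
  -- Step 4: off the bad events, the pass event IS `{T'ₙ ≤ −z}`; squeeze
  set A : ℕ → Set (ΩA × ΩB) := fun n => {ω | |SA n ω.1 - SB (m n) ω.2|
    + z * Real.sqrt (VA n ω.1 + VB (m n) ω.2) ≤ ε} with hA
  set B : ℕ → Set (ΩA × ΩB) := fun n => (fun ω : ΩA × ΩB =>
    (SA n ω.1 - SB' (m n) ω.2) / Real.sqrt (VA n ω.1 + VB (m n) ω.2)) ⁻¹' Iic (-z) with hB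
  set N : ℕ → Set (ΩA × ΩB) := fun n => {ω : ΩA × ΩB | (n : ℝ) * VA n ω.1 ≤ sA / 2}
    ∪ {ω : ΩA × ΩB | SA n ω.1 - SB (m n) ω.2 ≤ ε / 2} with hN
  have hagree : ∀ n : ℕ, 1 ≤ n → ∀ ω, ω ∉ N n → (ω ∈ A n ↔ ω ∈ B n) := by
    intro n hn1 ω hω
    simp only [hN, mem_union, mem_setOf_eq, not_or, not_le] at hω
    obtain ⟨hV, hDpos⟩ := hω
    have hn0 : (0 : ℝ) < n := by exact_mod_cast hn1
    have hVApos : 0 < VA n ω.1 := by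
      by_contra hle
      have : (n : ℝ) * VA n ω.1 ≤ 0 := mul_nonpos_of_nonneg_of_nonpos hn0.le (not_lt.1 hle)
      linarith
    have hs : 0 < Real.sqrt (VA n ω.1 + VB (m n) ω.2) :=
      Real.sqrt_pos.2 (add_pos_of_pos_of_nonneg hVApos (hVB0 _ _))
    have habs : |SA n ω.1 - SB (m n) ω.2| = SA n ω.1 - SB (m n) ω.2 := abs_of_pos (by linarith)
    simp only [hA, hB, mem_setOf_eq, mem_preimage, mem_Iic, habs, div_le_iff₀ hs]
    constructor <;> intro h1 <;> linarith
  have hNbound : ∀ n : ℕ, (PA.prod PB).real (N n)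
      ≤ (PA.prod PB).real {ω : ΩA × ΩB | (n : ℝ) * VA n ω.1 ≤ sA / 2}
        + (PA.prod PB).real {ω : ΩA × ΩB | SA n ω.1 - SB (m n) ω.2 ≤ ε / 2} :=
    fun n => measureReal_union_le _ _
  have hupper : ∀ᶠ n : ℕ in atTop, (PA.prod PB).real (A n) ≤ (PA.prod PB).real (B n) + (PA.prod PB).real (N n) := by
    filter_upwards [eventually_ge_atTop 1] with n hn1
    calc (PA.prod PB).real (A n) ≤ (PA.prod PB).real (B n ∪ N n) :=
          measureReal_mono fun ω hω => by
            by_cases hωN : ω ∈ N n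
            · exact Or.inr hωN
            · exact Or.inl ((hagree n hn1 ω hωN).1 hω)
      _ ≤ (PA.prod PB).real (B n) + (PA.prod PB).real (N n) := measureReal_union_le _ _
  have hlower : ∀ᶠ n : ℕ in atTop, (PA.prod PB).real (B n) - (PA.prod PB).real (N n) ≤ (PA.prod PB).real (A n) := by
    filter_upwards [eventually_ge_atTop 1] with n hn1
    have : (PA.prod PB).real (B n) ≤ (PA.prod PB).real (A n) + (PA.prod PB).real (N n) :=
      calc (PA.prod PB).real (B n) ≤ (PA.prod PB).real (A n ∪ N n) :=
            measureReal_mono fun ω hω => by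
              by_cases hωN : ω ∈ N n
              · exact Or.inr hωN
              · exact Or.inl ((hagree n hn1 ω hωN).2 hω)
        _ ≤ (PA.prod PB).real (A n) + (PA.prod PB).real (N n) := measureReal_union_le _ _
    linarith
  have hNto : Tendsto (fun n : ℕ => (PA.prod PB).real (N n)) atTop (𝓝 0) :=
    tendsto_of_tendsto_of_tendsto_of_le_of_le tendsto_const_nhds hbad
      (fun n => measureReal_nonneg) hNbound
  have hlo := hlim.sub hNto
  have hhi := hlim.add hNto
  rw [sub_zero] at hlo
  rw [add_zero] at hhi
  exact tendsto_of_tendsto_of_tendsto_of_le_of_le' hlo hhi hlower hupper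

end Tolerance

end Summit.Ventures.LatticeQCDFlow.Scoring.CardConsistency

end
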